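import Literature.IUT.HodgeArakelov.MonoThetaProjectiveProp16Characteristic
import Literature.IUT.HodgeArakelov.MonoThetaCyclotomesBridgeEtTh
import Literature.AnabelianGeometry.EtaleTheta.RigidOfSetting

/-!
# [IUTchII] Prop. 1.6 (i)/(ii) AT THE [EtTh] MODEL: the typed core / cuspidalisation outputs of the
# setting `ThetaSetting.ofDoubleUnderline` are inhabited modulo [EtTh] Cor. 2.18 (i) BY NAME
# (proof-only companion)

PROOF-ONLY companion (theorems only; no `def`, no new named fact) of abc-iut-L6-t1's frozen
`MonoThetaProjective.lean` (p407497), over abc-iut-L6-t1/L6-d6's bridge B8 setting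
`ThetaSetting.ofDoubleUnderline` (`MonoThetaCyclotomesBridgeEtTh`) and abc-iut-L2-t8's §1 instantiation
`rigidData` of the [EtTh] §2 rigidity interface (`RigidOfSetting`). abc-iut cell, wave-5 seat
abc-iut-w5-d030; DAG nodes **IUTchII:Prop1.6(i)**, **IUTchII:Prop1.6(ii)** (layer L6, outside the
[IUTchIII] Cor. 3.12 cone). S. Mochizuki, *Inter-universal Teichmüller theory II*, kurims manuscript
(Dec. 2020), §1, Prop. 1.6, p. 31 l. 10–12: "Write `Δ ⊆ Π` for the [group-theoretic! — cf., e.g.,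
[AbsAnab], Lemma 1.3.8] subgroup corresponding to `Δ^tp_{X̲̲_k}`." [claim: Mochizuki2012, status: disputed]
(IUTchII §1 Prop 1.6, kurims p.31); S. Mochizuki, *The étale theta function …*, Publ. RIMS **45** (2009),
Cor. 2.18 (i) — typed by abc-iut-L2-t2 as the named fact `RigidData.Cor218_i` (`ThetaRigidity.lean`), whose
third conjunct is the `Δ`-clause `R.aug.ker.map γ = R.aug.ker` for every topological automorphism `γ` of
`Π^tp_X̲̲` [cite: MochizukiEtTh2009, Cor 2.18(i) p.60].

## What is proved

* `ThetaSetting.isTopCharacteristic_deltaX_ofDoubleUnderline_of_cor218_i` — at the model setting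
  `S := ofDoubleUnderline C μ hC hS …` (`Π^tp_{X̲̲_k} := C.Huu`, abc-iut-L2-t8), the [AbsAnab] Lem. 1.3.8
  INPUT of the typed Prop. 1.6 (i) (`IsTopCharacteristic S.PiX S.DeltaX`, cf.
  `CoreData.nonempty_iff_isTopCharacteristic`, p413509) is LITERALLY the `Δ`-clause of
  `RigidData.Cor218_i` for `R := C.rigidData μ hC hS h15 L` (`rigidData_toThetaEnvData : … = … := rfl`),
  hence holds under that named fact — consumed BY NAME, the idiom of abc-iut-w4-d013 /
  `Discharge/Sec2Cor218ivOfSetting.lean` (no new `Prop` fact);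
* `ThetaSetting.nonempty_coreData_ofDoubleUnderline_of_cor218_i` — hence, under `Cor218_i`, the typed
  Prop. 1.6 (i) OUTPUT `CoreData S P` is inhabited for every `P ≃ₜ* Π^tp_{X̲̲_k}` at the [EtTh] model;
* `ThetaSetting.nonempty_ellipticCuspidalization_ofDoubleUnderline` — the typed Prop. 1.6 (ii) OUTPUT at
  the model is inhabited for every `P ≃ₜ* Π^tp_{X̲̲_k}` with NO input (its content-freeness,
  `EllipticCuspidalization.nonempty_iff`, p412824).

HONEST SCOPE: the witnesses are the interface-level ones of `MonoThetaProjectiveProp16Proofs`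
(`Π_C(Π) := Π`, `Π_{U_N}(Π) := Π`); the GENUINE tempered core `Π^tp_{C_k}` and the GENUINE elliptic
cuspidalisation `Π^tp_{U_N}` ([AbsTopII] Cor. 3.3 (i)/(iii)) are not in the tree and remain the MERGE-MAP
rows 91/92 (HOME/plan/L6/MERGE-MAP.md). The named fact `Cor218_i` is a HYPOTHESIS, not asserted
([EtTh] is refereed; FACT-policy, cell FOUNDATIONS row 39). The claim key `Mochizuki2012` is DISPUTED
(D-0012); nothing here takes a side on [IUTchIII] Cor. 3.12; typed ≠ discharged elsewhere.
-/

noncomputable section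

namespace Literature.IUT.HodgeArakelov

open Literature.AnabelianGeometry.EtaleTheta Literature.AnabelianGeometry.SemiGraphs
open scoped Literature.AnabelianGeometry.EtaleTheta

namespace ThetaSetting

variable {p : ℕ} [Fact p.Prime] {D : Literature.AnabelianGeometry.EtaleTheta.ThetaSetting p}
  {E : D.EtaleThetaData} {l : ℕ} (C : E.DoubleUnderline l) {N : ℕ+} (μ : D.CyclotomeMod l N)
  (hC : D.Compat) (hS : D.Sec2Hyps)

/-- **The [AbsAnab] Lem. 1.3.8 input of Prop. 1.6 (i) at the [EtTh] model, from [EtTh] Cor. 2.18 (i) BY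
NAME.** For `S := ofDoubleUnderline C μ hC hS …` (`Π^tp_{X̲̲_k} := C.Huu`) and the §1 instantiation
`R := C.rigidData μ hC hS h15 L` of the rigidity interface, the `Δ`-clause of `R.Cor218_i` ("the
subquotients … `(Π^tp_X ⊇) G_K` [i.e. `Δ_X`] … of `Π^tp_X`" are preserved by every topological
automorphism) IS `IsTopCharacteristic S.PiX S.DeltaX`. [cite: MochizukiEtTh2009, Cor 2.18(i) p.60] -/
theorem isTopCharacteristic_deltaX_ofDoubleUnderline_of_cor218_i (hl : l.Prime) (hp2 : p ≠ 2)
    (hpl : p ≠ l) (hζ : ∃ ζ : D.K, IsPrimitiveRoot ζ (4 * l))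
    {η : (C.thetaEnvData μ hC hS).PiYdd → MuN p N} (hη : η ∈ (C.thetaEnvData μ hC hS).thetaCocycles)
    (h15 : Literature.AnabelianGeometry.EtaleTheta.ThetaSetting.Prop15iii E hC) (L : C.CuspLabels)
    (h218i : (C.rigidData μ hC hS h15 L).Cor218_i) :
    IsTopCharacteristic (ofDoubleUnderline C μ hC hS hl hp2 hpl hζ hη).PiX
      (ofDoubleUnderline C μ hC hS hl hp2 hpl hζ hη).DeltaX :=
  fun φ => (h218i φ).2.2.1

/-- **IUTchII:Prop1.6(i) AT THE [EtTh] MODEL modulo [EtTh] Cor. 2.18 (i)**: under the named fact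
`Cor218_i` for `C.rigidData μ hC hS h15 L`, the typed Prop. 1.6 (i) OUTPUT `CoreData` of the setting
`ofDoubleUnderline C μ hC hS …` is inhabited over every topological group `P ≃ₜ* Π^tp_{X̲̲_k}`
(interface-level witness `Π_C(Π) := Π`; the genuine core `Π^tp_{C_k}` is MERGE-MAP row 91).
[claim: Mochizuki2012, status: disputed] (IUTchII §1 Prop 1.6 (i), kurims p.31) -/
theorem nonempty_coreData_ofDoubleUnderline_of_cor218_i (hl : l.Prime) (hp2 : p ≠ 2) (hpl : p ≠ l)
    (hζ : ∃ ζ : D.K, IsPrimitiveRoot ζ (4 * l))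
    {η : (C.thetaEnvData μ hC hS).PiYdd → MuN p N} (hη : η ∈ (C.thetaEnvData μ hC hS).thetaCocycles)
    (h15 : Literature.AnabelianGeometry.EtaleTheta.ThetaSetting.Prop15iii E hC) (L : C.CuspLabels)
    (h218i : (C.rigidData μ hC hS h15 L).Cor218_i) {P : TopGroup.{0}}
    (e : P ≃ₜ* (ofDoubleUnderline C μ hC hS hl hp2 hpl hζ hη).PiX) :
    Nonempty (CoreData (ofDoubleUnderline C μ hC hS hl hp2 hpl hζ hη) P) :=
  CoreData.nonempty_of_isTopCharacteristic e
    (isTopCharacteristic_deltaX_ofDoubleUnderline_of_cor218_i C μ hC hS hl hp2 hpl hζ hη h15 L h218i)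

/-- **IUTchII:Prop1.6(ii) AT THE [EtTh] MODEL, no input**: the typed Prop. 1.6 (ii) OUTPUT
`EllipticCuspidalization` of the setting `ofDoubleUnderline C μ hC hS …` is inhabited, for every label
`M` and every `P ≃ₜ* Π^tp_{X̲̲_k}` (interface-level witness `Π_{U_M}(Π) := Π`; the genuine elliptic
cuspidalisation of [AbsTopII] Cor. 3.3 (iii) is MERGE-MAP row 92).
[claim: Mochizuki2012, status: disputed] (IUTchII §1 Prop 1.6 (ii), kurims p.31) -/
theorem nonempty_ellipticCuspidalization_ofDoubleUnderline (hl : l.Prime) (hp2 : p ≠ 2) (hpl : p ≠ l)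
    (hζ : ∃ ζ : D.K, IsPrimitiveRoot ζ (4 * l))
    {η : (C.thetaEnvData μ hC hS).PiYdd → MuN p N} (hη : η ∈ (C.thetaEnvData μ hC hS).thetaCocycles)
    (M : ℕ+) {P : TopGroup.{0}} (e : P ≃ₜ* (ofDoubleUnderline C μ hC hS hl hp2 hpl hζ hη).PiX) :
    Nonempty (EllipticCuspidalization (ofDoubleUnderline C μ hC hS hl hp2 hpl hζ hη) M P) :=
  EllipticCuspidalization.nonempty_iff.2 ⟨e⟩

end ThetaSetting

end Literature.IUT.HodgeArakelov

end
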